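import Summits.AtomisticToContinuum.BoseEinsteinCondensation.Theses.BECConjugateDomination
import Literature.MathematicalPhysics.QuantumManyBody.BoseGasBoundaryConditionIndependence
import Summits.AtomisticToContinuum.BoseEinsteinCondensation.Theorems.HardCoreExtension.Negative.UniformRepairNormalForm
import Summits.AtomisticToContinuum.BoseEinsteinCondensation.Theorems.PuffFloor.Negative.PuffFloorFalseForNearMinimisers

/-!
# Line `near-minimiser-slack-transfer` — skeleton for crux `HardCoreExtension` (stmt-AtomisticToContinuum-11786)

Route `route-AtomisticToContinuum-BECConjugateDomination`; crux decl
`Summit.AtomisticToContinuum.BoseEinsteinCondensation.Theses.BECConjugateDomination.HardCoreExtension`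
(`SmoothClassBEC → BoseEinsteinCondensation`), concluded BY NAME by `HardCoreExtension_of` below from the three
registered stubs and the route item `BoundaryTransferWeak` (stmt-AtomisticToContinuum-0827, used PER POTENTIAL, as filed).
Planner version v2 (crux-plan gen 2, 2026-08-16, written against `Disproof.lean` GEN 3); v1 (gen 1, same three stubs,
same compositions) was written against Disproof gen 2. Delta v1 → v2: (i) the stub signatures are INLINED over tree
declarations (the registered signature of each `stub_*` is now the precise `Prop`, with the smooth class spelled out as
the parenthesised conjunction that `IsSmoothClass` unfolds to — `example`s below certify the stubs are definitionally the
named `Prop`s `UniformSmoothPeriodicBEC` / `SlackUniformisation` / `EnergyApproximation`); (ii) every stub is audited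
against the gen-3 trichotomy of Disproof §10/§11 (T5) — see "Disproof.lean (gen 3) honoured"; (iii) the landed negative
lemma behind §10 (`PuffFloor.Negative.puffFloor_false_for_nearMinimisers`, the sibling of `Negative/QuadraticFloorNearMinFalse.lean`
p76160 — the latter read, not importable on the farm at check time) is imported into this check. Line card `Lines/near-minimiser-slack-transfer.md`.

## The line (idea card `Ideas/near-minimiser-slack-transfer.md`, sharpened by TRIAGE-r1-1/2/3)

SLACK MATCHING. The periodic trial class `PeriodicTrialState N L` does not depend on the potential. If a potential `w`
is `ε`-close to `v` IN ENERGY at fixed `(N, L)` — (a) `E_w(Ψ) ≤ E_v(Ψ) + ε` on the `ε`-near-minimisers of `v` and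
(b) `E₀(v) ≤ E₀(w) + ε` — then every `ε`-near-minimiser of `v` is a `3ε`-near-minimiser of `w`
(`E_w Ψ ≤ E_v Ψ + ε ≤ E₀(v) + 2ε ≤ E₀(w) + 3ε`). So a condensation bound holding for ALL `δ`-near-minimisers of ALL
members `w` of a class `𝒮`, with ONE slack `δ`, passes to `v` with slack `δ/4` as soon as `v` is `δ/4`-approximable
in energy by members of `𝒮` (`slackTransfer`, PROVED; no spectral data, no regularity, no convergence of states).

Three stubs feed it, for `𝒮 = 𝒮_R` = the route's smooth class with range `≤ R` (`IsSmoothClass R`):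

* `stub_uniformSmoothPeriodicBEC` (T, the load-bearing thermodynamic stub, crux strength): the route's TARGET
  `SmoothPeriodicBEC` (stmt-11783) with `ρ₀, c, N₀` UNIFORM over `𝒮_R` (the slack `δ` still per potential). It is what
  the route's chain `IMUChainGlue` outputs once its constants are audited to depend on `v ∈ 𝒮_R` through `R` only
  (proved reduction `uniformSmoothPeriodicBEC_of_minimiser` below: T ⟸ `UniformMinimiserCondensation` ∧
  `PositiveMinimiser` (11787) ∧ `NearMinimiserStability` (11788)); the companion line `third-law-current-floor`
  builds exactly such a uniform chain (its S2–S4) — a lead may feed T from there.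
* `stub_slackUniformisation` (F, fixed volume): at each large `N` and `ρ < ρ₁(R)`, per-potential slacks on `𝒮_R` can be
  replaced by ONE slack at the price `c ↦ c/2` (Γ-compactness of `{q_v : v ∈ 𝒮_R}` at fixed `(N, L)`, continuity of
  `n₀` under `L²`-convergence, and simplicity of the bosonic ground state of every dilute Γ-limit — caged sectors cost
  `≥ π²/R² − 16πRρ > 0` uniformly in `N`).
* `stub_energyApproximation` (A, fixed volume): EVERY repulsive finite-range `v` (hard cores, hard fat-Cantor shells, kinks,
  non-lsc steps…) is `ε`-approximable in energy, in the sense (a)+(b), by members of `𝒮_R`, `R = R(v)`, at every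
  `(N, L, ε)` with `E₀^per(v; N, L) < ∞` — NOT by pointwise minorants (false for non-lsc `v`, card) but by
  `k·b_k` on shrinking neighbourhoods of the hard set (Hardy/Poincaré transversal to the hard wall) plus truncation and
  `ζ⁴`-mollification of the finite part (Sobolev on pair marginals; monotone convergence of forms; Bagby–Hedberg).

Composition (all PROVED here): `finitePeriodicEnergy` (tree) + A + [T + F ⇒ one slack] + `slackTransfer` ⇒
`PeriodicBEC(v)` for every repulsive finite-range `v` (`periodicBEC_of`) ⇒ `BoundaryTransferWeak` per potential ⇒ the
conjunct ⇒ the crux (`HardCoreExtension_of`; the crux's own non-uniform antecedent is not used — Disproof §5/§9/§11: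
it cannot be).

## Disproof.lean (gen 3) honoured
* §1 `not_crux_iff` (`¬crux ↔ A ∧ ¬B`): the line proves `B` outright on the torus side, antecedent idle — the only
  honest shape; T is openly crux-strength (§8: "`UniformSmoothPeriodicBEC` crux-strength, consistent at `v = 0`").
* §3 / `Negative.HighDensityObstruction`: every statement is DILUTE (`ρ < ρ₀(R)`, `ρ < ρ₁(R)`, `ρ < (1+R)⁻³`), never
  all densities (`not_hasGroundStateBEC_allDensities`).
* §4 `not_hasGroundStateBEC_mono_potential` / `not_condensateNumber_mono_potential`: no monotonicity in `v` is used —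
  only set inclusion of near-minimiser SETS at matched slack (`slackTransfer`), one direction; §4b
  `windowInf_le_condensateNumber_of_le` is the ancestor of `slackTransfer` (window error made `o(1)` by (a)/(b), ONE `δ`
  from T ∧ F).
* §6 / `Negative.ScalingReductions` (`not_conjunctClass_uniformRho`, `uniformRhoAntecedent_iff_allDensities`,
  `hardCoreExtension_iff_unitRange`) and `Negative.UniformRepairNormalForm` (`uniformSmoothBEC_iff_unitRange`): the
  uniform thresholds `ρ₀, ρ₁` depend on the LENGTH `R` (T at `R` ⇔ T at `1` by dilation; no scale-free uniformity).
* §7 `not_monotoneLimitTransfer` (fixed-box degeneracy junk): F carries the guards `ρ < ρ₁(R)` and `∀ᶠ N`; caged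
  sectors are gapped away uniformly in `N`; no minimiser-to-limit transfer of eigenvectors is stated (T speaks of
  near-minimisers, A of energies only; the limit objects live inside F's proof, never in a signature — cf. TRIAGE
  r1-2 (N4) on the vacuity of naming a `C¹` limit state).
* §8: `IdeatorTwo.FiniteEnergyAtLowDensity` proved there (`Negative.finiteEnergyAtLowDensity`); its periodic twin
  `finitePeriodicEnergy` is proved HERE; `IdeatorTwo.NonLscResidueBEC` (flagged "crux-strength residue") is ELIMINATED
  by A; `IdeatorTwo.SmoothMinorantApproximation` (lsc only) is superseded by A.
* §10/§11 (gen 3) TRICHOTOMY AUDIT (T5: "every stub quantifying over states must be checked: exact ⇒ vacuous on hard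
  cores; near + all modes ⇒ UV-false unless the functional is `L²`-Lipschitz uniformly in the mode or capped"):
  T — NEAR-minimisers, of SMOOTH-class `v` only (finite, `C²`: `C³` positive minimisers exist by 11787, so neither
  the near- nor the exact-minimiser reading is vacuous), functional = `condensateOccupation` (ONE mode, the constant
  one; `2N`-Lipschitz on the `L²` unit sphere — §11 (i): the UV witness moves it by `O(N√(δ/gap)) = o(N)` only) ✓;
  F — same states, same functional ✓; A — quantifies over near-minimisers of an ARBITRARY admissible `v` (hard cores
  included: they EXIST in the `C¹` class whenever `E₀^per ≠ ⊤`, which A assumes; no exact minimiser is ever named)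
  and tests them only through ENERGIES `E_w(Ψ) − E_v(Ψ)`, controlled on the sublevel set `{E_v ≤ E₀ + ε}` by the
  kinetic energy (Hardy/Sobolev) — mode-free ✓; `UniformMinimiserCondensation` (not registered) — EXACT positive
  minimisers of SMOOTH-class `v`: non-vacuous by 11787 ✓. No stub is a structure-factor floor; the landed
  `Negative.quadraticFloorNearMin_false` (p76160, read) and `PuffFloor.Negative.puffFloor_false_for_nearMinimisers` (imported)
  refute nothing here. §11 (iii) uniformity corners of T
  (weak-wide `𝔞 ≪ R`, tall-thin `t·φ →` hard core): consistent under the dilute guard `ρ < ρ₀(R)` — recorded as T's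
  "why it might fail".
-/

noncomputable section

namespace Summit.AtomisticToContinuum.BoseEinsteinCondensation.Cruxes.HardCoreExtension.NearMinimiserSlackTransfer

open Literature.MathematicalPhysics.QuantumManyBody.BoseGas
open _root_.MeasureTheory _root_.Filter
open scoped ENNReal Topology
open Summit.AtomisticToContinuum.BoseEinsteinCondensation.Theses

/-! ## Vocabulary -/

/-- The smooth class of the route with range `≤ R`: repulsive finite range, finite, `C²` as `ṽ(x) = v(|x|)` on `ℝ³`,
edge condition `‖D²ṽ‖ ≤ Cₑ√ṽ` (the four curried hypotheses of `SmoothPeriodicBEC` / `PositiveMinimiser` /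
`NearMinimiserStability`, verbatim), and `v = 0` beyond `R` (then `𝔞(v) ≤ R`, `scatteringLength_le_range`).
The registered stubs spell this conjunction out literally (same parenthesisation), so they unfold to the named `Prop`s. -/
def IsSmoothClass (R : ℝ) (v : ℝ → ℝ≥0∞) : Prop :=
  IsRepulsiveFiniteRange v ∧ (∀ r, v r ≠ ⊤) ∧ ContDiff ℝ 2 (fun x : Space => (v ‖x‖).toReal) ∧
    (∃ Cₑ : ℝ, ∀ x : Space,
      ‖iteratedFDeriv ℝ 2 (fun x : Space => (v ‖x‖).toReal) x‖ ≤ Cₑ * Real.sqrt ((v ‖x‖).toReal)) ∧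
    (∀ r, R < r → v r = 0)

/-- The free gas is in every `𝒮_R` (edge constant `0`): the class is not empty, T below is not vacuous. -/
theorem isSmoothClass_zero (R : ℝ) : IsSmoothClass R 0 := by
  refine ⟨⟨measurable_const, 0, fun _ _ => rfl⟩, fun _ => ENNReal.zero_ne_top, ?_, ⟨0, fun x => ?_⟩,
    fun _ _ => rfl⟩
  · simpa using contDiff_const (c := (0 : ℝ))
  · simp

/-! ## The three statements of the line (named `Prop`s; the registered stubs below unfold to them) -/

/-- **T — uniform smooth-class periodic BEC** (the route's target `SmoothPeriodicBEC`, stmt-11783, with `ρ₀, c, N₀`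
uniform over the class `𝒮_R`; the slack `δ` may still depend on the potential). For every range bound `R > 0`
there is `ρ₀ = ρ₀(R) > 0` such that for `0 < ρ < ρ₀` there is `c > 0` with: for all large `N` and EVERY `v ∈ 𝒮_R`
some `δ = δ(v, N) > 0` makes every periodic trial state on the torus of side `(N/ρ)^{1/3}` with
`periodicEnergy ≤ E₀^per + δ` have constant-mode occupation `≥ cN`. By dilation (`Negative.ScalingReductions`)
T at `R` is T at `1` with `ρ₀(R) = ρ₀(1)/R³`; `v = 0 ∈ 𝒮_R`: `n₀ ≥ N − δ(L/2π)²`. -/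
def UniformSmoothPeriodicBEC : Prop :=
  ∀ R : ℝ, 0 < R → ∃ ρ₀ : ℝ, 0 < ρ₀ ∧ ∀ ρ : ℝ, 0 < ρ → ρ < ρ₀ → ∃ c : ℝ, 0 < c ∧
    ∀ᶠ N : ℕ in atTop, ∀ v : ℝ → ℝ≥0∞, IsSmoothClass R v →
      ∃ δ : ℝ≥0∞, 0 < δ ∧ ∀ Ψ : PeriodicTrialState N (sideLength ρ N),
        periodicEnergy v Ψ ≤ periodicGroundStateEnergy v N (sideLength ρ N) + δ →
          ENNReal.ofReal (c * N) ≤ condensateOccupation N (sideLength ρ N) Ψ.ψ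

/-- **F — slack uniformisation at fixed volume.** For `R > 0` there is `ρ₁ = ρ₁(R) > 0` such that for
`0 < ρ < ρ₁`, every `c > 0` and all large `N`: if every `v ∈ 𝒮_R` has its own slack `δ_v > 0` below which all
near-minimisers on the torus of side `(N/ρ)^{1/3}` have `n₀ ≥ cN`, then ONE slack `δ > 0` serves the whole class
with `n₀ ≥ (c/2)N`. Intended proof: if not, `v_k ∈ 𝒮_R` and `(1/k)`-near-minimisers `Ψ_k` with `n₀(Ψ_k) < cN/2`;
at fixed `(N, L)` the closed forms `{q_v : v ∈ 𝒮_R}` are equicoercive and Γ-compact (Dal Maso–Mosco: limits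
`−Δ + μ`, `μ` a nonnegative periodic pair measure of range `≤ R`, `+∞` parts = hard sets / opaque shells), `Ψ_k → Ψ`
and the minimisers `Φ_k → Φ` in `L²` (Rellich), both ground states of the limit, `n₀(Ψ) ≤ cN/2 < cN ≤ n₀(Φ)`
(`n₀` is `2N`-Lipschitz); contradiction once the limit's bosonic ground state is SIMPLE — at `ρ < ρ₁(R)` every sector
with a caged pair costs `≥ π²/R²` (Dirichlet cavity/gap of width `≤ R`, reduced mass) while removing two particles from
the dilute free sector saves only `O(ρR)`, uniformly in `N`; what is left is connectivity mod `S_N` of the dilute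
hard-sphere free sector on the torus (the discrete-geometry lemma this stub must supply; Baryshnikov–Bubenik–Kahle),
or the connectivity-free fallback of the line card. NOT implied by C⁺ below (it uniformises at EVERY level `c`). -/
def SlackUniformisation : Prop :=
  ∀ R : ℝ, 0 < R → ∃ ρ₁ : ℝ, 0 < ρ₁ ∧ ∀ ρ : ℝ, 0 < ρ → ρ < ρ₁ → ∀ c : ℝ, 0 < c →
    ∀ᶠ N : ℕ in atTop,
      (∀ v : ℝ → ℝ≥0∞, IsSmoothClass R v →
        ∃ δ : ℝ≥0∞, 0 < δ ∧ ∀ Ψ : PeriodicTrialState N (sideLength ρ N),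
          periodicEnergy v Ψ ≤ periodicGroundStateEnergy v N (sideLength ρ N) + δ →
            ENNReal.ofReal (c * N) ≤ condensateOccupation N (sideLength ρ N) Ψ.ψ) →
      ∃ δ : ℝ≥0∞, 0 < δ ∧ ∀ v : ℝ → ℝ≥0∞, IsSmoothClass R v →
        ∀ Ψ : PeriodicTrialState N (sideLength ρ N),
          periodicEnergy v Ψ ≤ periodicGroundStateEnergy v N (sideLength ρ N) + δ →
            ENNReal.ofReal (c / 2 * N) ≤ condensateOccupation N (sideLength ρ N) Ψ.ψ

/-- **A — energy approximation by the smooth class, for EVERY repulsive finite-range potential.** For each such `v`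
there is a range bound `R = R(v) > 0` such that at every `(N, L)` with `L > 0` and `E₀^per(v; N, L) < ∞` and every
`ε > 0` some `w ∈ 𝒮_R` is `ε`-close to `v` in energy: (a) `E_w(Ψ) ≤ E_v(Ψ) + ε` for every `ε`-near-minimiser `Ψ` of
`v`, and (b) `E₀^per(v) ≤ E₀^per(w) + ε`. NOT a pointwise minorant statement (those fail for non-lsc `v`, e.g.
`V₀·1_K`, `K` a fat Cantor set): hard part `⊤·1_H` (`H` the essentially closed hard set) ↦ `k·b_η`, `b_η` a
`ζ⁴`-mollified indicator of the `η`-neighbourhood of `H`, `k η² → 0` — (a) by Poincaré/Hardy transversal to the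
hard wall `{|xᵢ−xⱼ| ∈ H}` where finite-energy states vanish (`BoseGasHardSet`), (b) by `k·b_η ≥ k·1_H ↑ ⊤·1_H`
(monotone convergence of closed forms at fixed volume; `C¹` core = form domain by the Bagby–Hedberg characterisation
of `W₀^{1,2}` plus absolute continuity on a.e. radial line); finite part `u` ↦ `ζ⁴ * min(u, k)` — (a) by
`‖(ζ⁴*u_k − u_k)₊‖_{L³} → 0` and Sobolev `H¹ ↪ L³` on pair marginals at fixed `(N, L)`, (b) by truncation `min(u,k) ↑ u`
plus the same two-sided estimate; edge condition of a `ζ⁴`-mollification: `|D²(u * ζ⁴)| ≤ C_ζ ‖u‖₁^{1/2} √(u * ζ⁴)`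
(Cauchy–Schwarz). `v ∈` smooth class: `w = v`. -/
def EnergyApproximation : Prop :=
  ∀ v : ℝ → ℝ≥0∞, IsRepulsiveFiniteRange v → ∃ R : ℝ, 0 < R ∧
    ∀ (N : ℕ) (L : ℝ), 0 < L → periodicGroundStateEnergy v N L ≠ ⊤ →
      ∀ ε : ℝ≥0∞, 0 < ε → ∃ w : ℝ → ℝ≥0∞, IsSmoothClass R w ∧
        (∀ Ψ : PeriodicTrialState N L,
          periodicEnergy v Ψ ≤ periodicGroundStateEnergy v N L + ε →
            periodicEnergy w Ψ ≤ periodicEnergy v Ψ + ε) ∧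
        periodicGroundStateEnergy v N L ≤ periodicGroundStateEnergy w N L + ε

/-! ## The three registered stubs (signatures inlined over tree declarations) -/

/-- Registered stub **T** (hardest; crux strength — it contains thermodynamic-limit BEC for smooth potentials with
`R`-uniform constants). The hypothesis in parentheses is `IsSmoothClass R v` spelled out. -/
theorem stub_uniformSmoothPeriodicBEC :
    ∀ R : ℝ, 0 < R → ∃ ρ₀ : ℝ, 0 < ρ₀ ∧ ∀ ρ : ℝ, 0 < ρ → ρ < ρ₀ → ∃ c : ℝ, 0 < c ∧
      ∀ᶠ N : ℕ in atTop, ∀ v : ℝ → ℝ≥0∞,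
        (IsRepulsiveFiniteRange v ∧ (∀ r, v r ≠ ⊤) ∧ ContDiff ℝ 2 (fun x : Space => (v ‖x‖).toReal) ∧
          (∃ Cₑ : ℝ, ∀ x : Space,
            ‖iteratedFDeriv ℝ 2 (fun x : Space => (v ‖x‖).toReal) x‖ ≤ Cₑ * Real.sqrt ((v ‖x‖).toReal)) ∧
          (∀ r, R < r → v r = 0)) →
        ∃ δ : ℝ≥0∞, 0 < δ ∧ ∀ Ψ : PeriodicTrialState N (sideLength ρ N),
          periodicEnergy v Ψ ≤ periodicGroundStateEnergy v N (sideLength ρ N) + δ →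
            ENNReal.ofReal (c * N) ≤ condensateOccupation N (sideLength ρ N) Ψ.ψ := by
  sorry

/-- Registered stub **F** (fixed-volume; size L on paper, XL in Lean). -/
theorem stub_slackUniformisation :
    ∀ R : ℝ, 0 < R → ∃ ρ₁ : ℝ, 0 < ρ₁ ∧ ∀ ρ : ℝ, 0 < ρ → ρ < ρ₁ → ∀ c : ℝ, 0 < c →
      ∀ᶠ N : ℕ in atTop,
        (∀ v : ℝ → ℝ≥0∞,
          (IsRepulsiveFiniteRange v ∧ (∀ r, v r ≠ ⊤) ∧ ContDiff ℝ 2 (fun x : Space => (v ‖x‖).toReal) ∧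
            (∃ Cₑ : ℝ, ∀ x : Space,
              ‖iteratedFDeriv ℝ 2 (fun x : Space => (v ‖x‖).toReal) x‖ ≤ Cₑ * Real.sqrt ((v ‖x‖).toReal)) ∧
            (∀ r, R < r → v r = 0)) →
          ∃ δ : ℝ≥0∞, 0 < δ ∧ ∀ Ψ : PeriodicTrialState N (sideLength ρ N),
            periodicEnergy v Ψ ≤ periodicGroundStateEnergy v N (sideLength ρ N) + δ →
              ENNReal.ofReal (c * N) ≤ condensateOccupation N (sideLength ρ N) Ψ.ψ) →
        ∃ δ : ℝ≥0∞, 0 < δ ∧ ∀ v : ℝ → ℝ≥0∞,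
          (IsRepulsiveFiniteRange v ∧ (∀ r, v r ≠ ⊤) ∧ ContDiff ℝ 2 (fun x : Space => (v ‖x‖).toReal) ∧
            (∃ Cₑ : ℝ, ∀ x : Space,
              ‖iteratedFDeriv ℝ 2 (fun x : Space => (v ‖x‖).toReal) x‖ ≤ Cₑ * Real.sqrt ((v ‖x‖).toReal)) ∧
            (∀ r, R < r → v r = 0)) →
          ∀ Ψ : PeriodicTrialState N (sideLength ρ N),
            periodicEnergy v Ψ ≤ periodicGroundStateEnergy v N (sideLength ρ N) + δ →
              ENNReal.ofReal (c / 2 * N) ≤ condensateOccupation N (sideLength ρ N) Ψ.ψ := by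
  sorry

/-- Registered stub **A** (fixed-volume; size L on paper, XL in Lean). -/
theorem stub_energyApproximation :
    ∀ v : ℝ → ℝ≥0∞, IsRepulsiveFiniteRange v → ∃ R : ℝ, 0 < R ∧
      ∀ (N : ℕ) (L : ℝ), 0 < L → periodicGroundStateEnergy v N L ≠ ⊤ →
        ∀ ε : ℝ≥0∞, 0 < ε → ∃ w : ℝ → ℝ≥0∞,
          (IsRepulsiveFiniteRange w ∧ (∀ r, w r ≠ ⊤) ∧ ContDiff ℝ 2 (fun x : Space => (w ‖x‖).toReal) ∧
            (∃ Cₑ : ℝ, ∀ x : Space,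
              ‖iteratedFDeriv ℝ 2 (fun x : Space => (w ‖x‖).toReal) x‖ ≤ Cₑ * Real.sqrt ((w ‖x‖).toReal)) ∧
            (∀ r, R < r → w r = 0)) ∧
          (∀ Ψ : PeriodicTrialState N L,
            periodicEnergy v Ψ ≤ periodicGroundStateEnergy v N L + ε →
              periodicEnergy w Ψ ≤ periodicEnergy v Ψ + ε) ∧
          periodicGroundStateEnergy v N L ≤ periodicGroundStateEnergy w N L + ε := by
  sorry

/-! The registered signatures ARE the named statements (definitional unfolding only; these `example`s are the
machine check that the inlined text and the documented `Prop`s agree). -/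

example : UniformSmoothPeriodicBEC := stub_uniformSmoothPeriodicBEC
example : SlackUniformisation := stub_slackUniformisation
example : EnergyApproximation := stub_energyApproximation

/-! ## Proved: finite periodic energy at low density (the fourth input, from the tree) -/

/-- Every repulsive finite-range `v` (hard cores included) has `0 < L_N` and `E₀^per(N, L_N) < ∞` eventually along
`L_N = (N/ρ)^{1/3}` for `ρ < (1+R)⁻³`, `R` a positive range of `v`: periodise the Dirichlet free-volume states of a
slightly denser box (`limsup_energyPerParticlePeriodic_le_limsup`, `limsup_lt_top_of_small`). -/
theorem finitePeriodicEnergy (v : ℝ → ℝ≥0∞) (hv : IsRepulsiveFiniteRange v) :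
    ∃ ρ₀ : ℝ, 0 < ρ₀ ∧ ∀ ρ : ℝ, 0 < ρ → ρ < ρ₀ →
      ∀ᶠ N : ℕ in atTop, 0 < sideLength ρ N ∧ periodicGroundStateEnergy v N (sideLength ρ N) ≠ ⊤ := by
  obtain ⟨R, hR, hvR⟩ := hv.exists_pos_range
  have hR3 : 0 < (1 + R) ^ 3 := by positivity
  refine ⟨((1 + R) ^ 3)⁻¹, by positivity, fun ρ hρ hlt => ?_⟩
  -- an intermediate density `ρ < ρ'' < (1+R)⁻³`
  set ρ'' : ℝ := (ρ + ((1 + R) ^ 3)⁻¹) / 2 with hρ''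
  have hρρ'' : ρ < ρ'' := by rw [hρ'']; linarith
  have hρ''pos : 0 < ρ'' := hρ.trans hρρ''
  have hρ''lt : ρ'' < ((1 + R) ^ 3)⁻¹ := by rw [hρ'']; linarith
  have hsmall : ρ'' * (1 + R) ^ 3 < 1 := by
    have := mul_lt_mul_of_pos_right hρ''lt hR3
    rwa [inv_mul_cancel₀ hR3.ne'] at this
  have hlim : limsup (energyPerParticlePeriodic v ρ) atTop < ⊤ :=
    (limsup_energyPerParticlePeriodic_le_limsup hv hρ hρρ'').trans_lt
      (limsup_lt_top_of_small hv.1 hvR hR hρ''pos hsmall)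
  have hev : ∀ᶠ N : ℕ in atTop, energyPerParticlePeriodic v ρ N < ⊤ :=
    Filter.eventually_lt_of_limsup_lt hlim
  filter_upwards [hev, eventually_gt_atTop 0] with N hN hN0
  refine ⟨sideLength_pos_of_pos hρ hN0, fun htop => ?_⟩
  unfold energyPerParticlePeriodic at hN
  rw [htop, ENNReal.top_div_of_ne_top (ENNReal.natCast_ne_top N)] at hN
  exact lt_irrefl _ hN

/-! ## Proved: the slack-matching transfer -/

/-- **Slack transfer** (the lever, proved). At fixed `(N, L)`: if for every `ε > 0` some member `w` of a class `S`
satisfies (a) `E_w Ψ ≤ E_v Ψ + ε` on the `ε`-near-minimisers `Ψ` of `v` and (b) `E₀(v) ≤ E₀(w) + ε`, and if ONE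
slack `δ` makes all `δ`-near-minimisers of all members of `S` have `n₀ ≥ m`, then all `δ/4`-near-minimisers of `v`
have `n₀ ≥ m` (`E_w Ψ ≤ E_v Ψ + δ/4 ≤ E₀(v) + δ/2 ≤ E₀(w) + 3δ/4`). No spectral information on `v`. -/
theorem slackTransfer {N : ℕ} {L : ℝ} (v : ℝ → ℝ≥0∞) (S : (ℝ → ℝ≥0∞) → Prop) (m : ℝ≥0∞)
    (happrox : ∀ ε : ℝ≥0∞, 0 < ε → ∃ w, S w ∧
      (∀ Ψ : PeriodicTrialState N L, periodicEnergy v Ψ ≤ periodicGroundStateEnergy v N L + ε →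
        periodicEnergy w Ψ ≤ periodicEnergy v Ψ + ε) ∧
      periodicGroundStateEnergy v N L ≤ periodicGroundStateEnergy w N L + ε)
    (hunif : ∃ δ : ℝ≥0∞, 0 < δ ∧ ∀ w, S w → ∀ Φ : PeriodicTrialState N L,
      periodicEnergy w Φ ≤ periodicGroundStateEnergy w N L + δ → m ≤ condensateOccupation N L Φ.ψ) :
    ∃ δ : ℝ≥0∞, 0 < δ ∧ ∀ Ψ : PeriodicTrialState N L,
      periodicEnergy v Ψ ≤ periodicGroundStateEnergy v N L + δ → m ≤ condensateOccupation N L Ψ.ψ := by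
  obtain ⟨δ, hδ, h⟩ := hunif
  have hε : 0 < δ / 2 / 2 := ENNReal.half_pos (ENNReal.half_pos hδ.ne').ne'
  obtain ⟨w, hw, ha, hb⟩ := happrox (δ / 2 / 2) hε
  refine ⟨δ / 2 / 2, hε, fun Ψ hΨ => h w hw Ψ ?_⟩
  have h3 : δ / 2 / 2 + δ / 2 / 2 + δ / 2 / 2 ≤ δ :=
    calc δ / 2 / 2 + δ / 2 / 2 + δ / 2 / 2 = δ / 2 + δ / 2 / 2 := by rw [ENNReal.add_halves]
      _ ≤ δ / 2 + δ / 2 := add_le_add_right ENNReal.half_le_self _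
      _ = δ := ENNReal.add_halves δ
  calc periodicEnergy w Ψ ≤ periodicEnergy v Ψ + δ / 2 / 2 := ha Ψ hΨ
    _ ≤ periodicGroundStateEnergy v N L + δ / 2 / 2 + δ / 2 / 2 := by gcongr
    _ ≤ periodicGroundStateEnergy w N L + δ / 2 / 2 + δ / 2 / 2 + δ / 2 / 2 := by gcongr
    _ = periodicGroundStateEnergy w N L + (δ / 2 / 2 + δ / 2 / 2 + δ / 2 / 2) := by
        simp only [add_assoc]
    _ ≤ periodicGroundStateEnergy w N L + δ := by gcongr

/-! ## Proved: compositions -/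

/-- **C⁺ — uniform smooth-class periodic BEC with ONE slack** (the card's transfer target `UniformSmoothClassBEC`,
moved to the torus as TRIAGE-r1-1/2/3 ask): T with `∃ δ` BEFORE `∀ v ∈ 𝒮_R`. Not registered: it is `T ∧ F` up to
`c ↦ c/2` (`uniformSlack_of`), and it is all the transfer consumes (`periodicBEC_of_uniformSlack`) — a lead who proves
C⁺ in one piece may bypass F. [Disproof §8: "crux-strength, consistent at `v = 0`".] -/
def UniformSlackSmoothPeriodicBEC : Prop :=
  ∀ R : ℝ, 0 < R → ∃ ρ₀ : ℝ, 0 < ρ₀ ∧ ∀ ρ : ℝ, 0 < ρ → ρ < ρ₀ → ∃ c : ℝ, 0 < c ∧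
    ∀ᶠ N : ℕ in atTop, ∃ δ : ℝ≥0∞, 0 < δ ∧ ∀ v : ℝ → ℝ≥0∞, IsSmoothClass R v →
      ∀ Ψ : PeriodicTrialState N (sideLength ρ N),
        periodicEnergy v Ψ ≤ periodicGroundStateEnergy v N (sideLength ρ N) + δ →
          ENNReal.ofReal (c * N) ≤ condensateOccupation N (sideLength ρ N) Ψ.ψ

/-- `T ∧ F ⇒ C⁺` (constant `c/2`, threshold `min ρ₀ ρ₁`). -/
theorem uniformSlack_of (hT : UniformSmoothPeriodicBEC) (hU : SlackUniformisation) :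
    UniformSlackSmoothPeriodicBEC := by
  intro R hR
  obtain ⟨ρT, hρT, hT'⟩ := hT R hR
  obtain ⟨ρU, hρU, hU'⟩ := hU R hR
  refine ⟨min ρT ρU, lt_min hρT hρU, fun ρ hρ hlt => ?_⟩
  obtain ⟨c, hc, hTN⟩ := hT' ρ hρ (hlt.trans_le (min_le_left _ _))
  refine ⟨c / 2, half_pos hc, ?_⟩
  filter_upwards [hTN, hU' ρ hρ (hlt.trans_le (min_le_right _ _)) c hc] with N h1 h2
  exact h2 h1

/-- **Periodic BEC for every repulsive finite-range potential** from C⁺ and A (and `finitePeriodicEnergy`): exactly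
the hypothesis of the route item `BoundaryTransferWeak` (stmt-0827) for `v`, same `c`, slack `δ/4`. -/
theorem periodicBEC_of_uniformSlack (hC : UniformSlackSmoothPeriodicBEC) (hA : EnergyApproximation)
    (v : ℝ → ℝ≥0∞) (hv : IsRepulsiveFiniteRange v) :
    ∃ ρ₀ : ℝ, 0 < ρ₀ ∧ ∀ ρ : ℝ, 0 < ρ → ρ < ρ₀ → ∃ c : ℝ, 0 < c ∧ ∀ᶠ N : ℕ in atTop,
      ∃ δ : ℝ≥0∞, 0 < δ ∧ ∀ Ψ : PeriodicTrialState N (sideLength ρ N),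
        periodicEnergy v Ψ ≤ periodicGroundStateEnergy v N (sideLength ρ N) + δ →
          ENNReal.ofReal (c * N) ≤ condensateOccupation N (sideLength ρ N) Ψ.ψ := by
  obtain ⟨R, hR, happ⟩ := hA v hv
  obtain ⟨ρC, hρC, hC'⟩ := hC R hR
  obtain ⟨ρF, hρF, hF'⟩ := finitePeriodicEnergy v hv
  refine ⟨min ρC ρF, lt_min hρC hρF, fun ρ hρ hlt => ?_⟩
  obtain ⟨c, hc, hCN⟩ := hC' ρ hρ (hlt.trans_le (min_le_left _ _))
  refine ⟨c, hc, ?_⟩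
  filter_upwards [hCN, hF' ρ hρ (hlt.trans_le (min_le_right _ _))] with N h1 h3
  exact slackTransfer v (IsSmoothClass R) _ (fun ε hε => happ N _ h3.1 h3.2 ε hε) h1

/-- The same from the three statements T, F, A (constant `c/2`). -/
theorem periodicBEC_of (hT : UniformSmoothPeriodicBEC) (hU : SlackUniformisation) (hA : EnergyApproximation)
    (v : ℝ → ℝ≥0∞) (hv : IsRepulsiveFiniteRange v) :
    ∃ ρ₀ : ℝ, 0 < ρ₀ ∧ ∀ ρ : ℝ, 0 < ρ → ρ < ρ₀ → ∃ c : ℝ, 0 < c ∧ ∀ᶠ N : ℕ in atTop,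
      ∃ δ : ℝ≥0∞, 0 < δ ∧ ∀ Ψ : PeriodicTrialState N (sideLength ρ N),
        periodicEnergy v Ψ ≤ periodicGroundStateEnergy v N (sideLength ρ N) + δ →
          ENNReal.ofReal (c * N) ≤ condensateOccupation N (sideLength ρ N) Ψ.ψ :=
  periodicBEC_of_uniformSlack (uniformSlack_of hT hU) hA v hv

/-- **The skeleton theorem.** `HardCoreExtension` BY NAME from the three registered stubs and the route item
`BoundaryTransferWeak` (stmt-AtomisticToContinuum-0827, shared crux, applied per potential as filed). The crux's
antecedent (non-uniform smooth-class Dirichlet BEC) is not used: the line proves the consequent. -/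
theorem HardCoreExtension_of (h : BECConjugateDomination.BoundaryTransferWeak) :
    BECConjugateDomination.HardCoreExtension :=
  fun _ v hv => h v hv
    (periodicBEC_of stub_uniformSmoothPeriodicBEC stub_slackUniformisation stub_energyApproximation v hv)

/-! ## Proved: where T comes from — the route's chain with `R`-uniform constants -/

/-- **Uniform condensation of positive minimisers** (not registered; the natural `R`-uniform output of the route's
chain `PositiveMinimiser → ShortDistanceCoherence → PuffFloor → InfraredMinimumUncertainty → …` BEFORE the stability
step (vi) of `IMUChainGlue`, and the conclusion shape of the companion line's `stub_uniformChainGlue` restricted to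
the smooth class): for `v ∈ 𝒮_R`, `ρ < ρ₀(R)`, `N ≥ N₀(ρ, R)`, every positive minimiser on the torus of side
`(N/ρ)^{1/3}` has `n₀ ≥ cN`, `c = c(ρ, R)`. The audit of the card: replace `E₀^per ≤ ρ‖ṽ‖₁N/2` in step (iv) by
`E₀^per(v) ≤ E₀^per(HS_{2R})` (`v ≤ ⊤·1_{[0,2R)}`; TRIAGE-r1-1 header) and take `κ = K√(ρ·R)`; then only
`InfraredMinimumUncertainty`'s `C(v)` and `PuffFloor`'s `Θ(v)` remain — T's genuine content. Exact positive
minimisers of SMOOTH-class `v` exist (11787), so this is not the vacuous exact-minimiser shape of Disproof §10. -/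
def UniformMinimiserCondensation : Prop :=
  ∀ R : ℝ, 0 < R → ∃ ρ₀ : ℝ, 0 < ρ₀ ∧ ∀ ρ : ℝ, 0 < ρ → ρ < ρ₀ → ∃ c : ℝ, 0 < c ∧
    ∀ᶠ N : ℕ in atTop, ∀ v : ℝ → ℝ≥0∞, IsSmoothClass R v →
      ∀ Ψ : PeriodicTrialState N (sideLength ρ N),
        periodicEnergy v Ψ = periodicGroundStateEnergy v N (sideLength ρ N) →
        periodicEnergy v Ψ ≠ ⊤ → (∀ X, Ψ.ψ X = (‖Ψ.ψ X‖ : ℂ)) → (∀ X, Ψ.ψ X ≠ 0) →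
          ENNReal.ofReal (c * N) ≤ condensateOccupation N (sideLength ρ N) Ψ.ψ

/-- **T from the uniform chain output and two route supports** (proved): uniform minimiser condensation, existence of
positive minimisers (`PositiveMinimiser`, stmt-11787) and per-potential near-minimiser stability
(`NearMinimiserStability`, stmt-11788, with `ε = c/2`) give `UniformSmoothPeriodicBEC` with constant `c/2`. -/
theorem uniformSmoothPeriodicBEC_of_minimiser (hT : UniformMinimiserCondensation)
    (hP : BECConjugateDomination.PositiveMinimiser) (hS : BECConjugateDomination.NearMinimiserStability) :
    UniformSmoothPeriodicBEC := by
  intro R hR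
  obtain ⟨ρ₀, hρ₀, h⟩ := hT R hR
  refine ⟨ρ₀, hρ₀, fun ρ hρ hlt => ?_⟩
  obtain ⟨c, hc, hN⟩ := h ρ hρ hlt
  refine ⟨c / 2, half_pos hc, ?_⟩
  filter_upwards [hN, eventually_ge_atTop 1] with N hTN hN1
  intro v hv
  obtain ⟨n, rfl⟩ : ∃ n, N = n + 1 := ⟨N - 1, (Nat.sub_add_cancel hN1).symm⟩
  have hL : 0 < sideLength ρ (n + 1) := sideLength_pos_of_pos hρ (Nat.succ_pos n)
  obtain ⟨Ψ, hmin, hfin, -, hreal, hpos⟩ :=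
    hP v hv.1 hv.2.1 hv.2.2.1 hv.2.2.2.1 n (sideLength ρ (n + 1)) hL
  have hcN := hTN v hv Ψ hmin hfin hreal hpos
  have hE : periodicGroundStateEnergy v (n + 1) (sideLength ρ (n + 1)) ≠ ⊤ := hmin ▸ hfin
  obtain ⟨δ, hδ, hstab⟩ :=
    hS v hv.1 hv.2.1 hv.2.2.1 hv.2.2.2.1 (n + 1) (sideLength ρ (n + 1)) hL hE (c / 2) (half_pos hc)
  refine ⟨δ, hδ, fun Φ hΦ => ?_⟩
  have h1 := hstab Ψ Φ hmin hΦ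
  have hc2 : 0 ≤ c / 2 * ((n + 1 : ℕ) : ℝ) := by positivity
  have hsplit : ENNReal.ofReal (c * ((n + 1 : ℕ) : ℝ)) =
      ENNReal.ofReal (c / 2 * ((n + 1 : ℕ) : ℝ)) + ENNReal.ofReal (c / 2 * ((n + 1 : ℕ) : ℝ)) := by
    rw [← ENNReal.ofReal_add hc2 hc2]
    congr 1
    ring
  rw [hsplit] at hcN
  exact (ENNReal.add_le_add_iff_right ENNReal.ofReal_ne_top).1 (hcN.trans h1)

/-- Conversely T gives the uniform minimiser statement outright (a minimiser is a `δ`-near-minimiser for every `δ`):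
registering T rather than `UniformMinimiserCondensation` loses nothing. -/
theorem uniformMinimiserCondensation_of (hT : UniformSmoothPeriodicBEC) : UniformMinimiserCondensation := by
  intro R hR
  obtain ⟨ρ₀, hρ₀, h⟩ := hT R hR
  refine ⟨ρ₀, hρ₀, fun ρ hρ hlt => ?_⟩
  obtain ⟨c, hc, hN⟩ := h ρ hρ hlt
  refine ⟨c, hc, ?_⟩
  filter_upwards [hN] with N hTN
  intro v hv Ψ hmin _ _ _
  obtain ⟨δ, _, hδ⟩ := hTN v hv
  exact hδ Ψ (hmin ▸ le_self_add)

end Summit.AtomisticToContinuum.BoseEinsteinCondensation.Cruxes.HardCoreExtension.NearMinimiserSlackTransfer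

end
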